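import Summits.PneNP.PneNP.Theorems.ExpanderLinearGeneratorsResSimToolkit

/-!
# PneNP / ExpanderLinearGenerators — bounded-depth `textbookFrege` p-simulates resolution:
the simulation

Route `PneNP/ExpanderLinearGenerators`, support for crux stmt-PneNP-11443. With the pieces of
`…ResSimToolkit`: a resolution refutation `ρ` of `T` (dag-like, with weakening; clauses of at most
`W` literals) yields a depth-`11` `textbookFrege` proof of `¬ ofCNF T` with at most
`(|ρ| + 1) · 300 K²` lines, `K = |ofCNF T| + 2W + |T| + 4`, each of size
`≤ 16 (|ofCNF T| + 3W + 3) + 60` — so of size polynomial in `|ρ|`, `W` and `|ofCNF T|`. The running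
proof contains, after `k` steps, the sequent `¬Φ ∨ ⋁C` of every clause `C` among the first `k`
lines of `ρ`; each further line costs one stand-alone tautology and at most two modus ponens steps.

* `step_initial`, `step_resolve`, `step_weaken` — one step of the running proof per resolution rule;
* `exists_proof_of_isResRefutation` — the simulation.

References: S. Cook, R. Reckhow, JSL 44 (1979), §2 (Frege systems p-simulate resolution,
folklore); J. Krajíček, *Proof complexity* (CUP 2019), §5.1; J. Shoenfield, *Mathematical Logic*
(1967), §2.6, §3.1.
-/

namespace Summit.PneNP.PneNP.Theorems.ResSim

open Literature.Computability.MetaComplexity Literature.Computability.MetaComplexity.TextbookFrege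
open Literature.Computability.Complexity (PropForm Clause CNF Literal)
open Literature.Computability.Complexity.PropForm
open Literature.Computability.MetaComplexity.KrajicekRamsey (litOf clauseOf dd_clauseOf_le dd_litOf_le)

/-! ### The literal list of a finite clause -/

/-- Members of the literal list of a clause. [folklore] -/
theorem mem_lits_iff {C : Finset (Literal ℕ)} {A : PropForm ℕ} :
    A ∈ C.toList.map litOf ↔ ∃ l ∈ C, litOf l = A := by
  simp [List.mem_map, Finset.mem_toList]

/-- Literal formulas have disjunct depth `≤ 1`. [folklore] -/
theorem dd_of_mem_lits {C : Finset (Literal ℕ)} {A : PropForm ℕ} (h : A ∈ C.toList.map litOf) :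
    A.dd ≤ 1 := by
  obtain ⟨l, -, rfl⟩ := mem_lits_iff.1 h
  exact dd_litOf_le l

/-- `msum` of the literal list of a clause is at most three times its cardinality. [folklore] -/
theorem msum_lits_le (C : Finset (Literal ℕ)) : msum (C.toList.map litOf) ≤ 3 * C.card := by
  have h : ∀ X ∈ C.toList.map litOf, X.size + 1 ≤ 3 := by
    intro X hX
    obtain ⟨l, -, rfl⟩ := mem_lits_iff.1 hX
    unfold litOf; split_ifs <;> simp [size]
  have := msum_le_length_mul h
  rwa [List.length_map, Finset.length_toList, mul_comm] at this

/-- The size of the sequent of a clause of at most `W` literals. [folklore] -/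
theorem size_lineF_le {Φ : PropForm ℕ} {C : Finset (Literal ℕ)} {W : ℕ} (hC : C.card ≤ W) :
    (disjList (neg Φ :: C.toList.map litOf)).size ≤ Φ.size + 3 * W + 3 := by
  rw [size_disjList_cons, size, size_disjList_eq_msum]
  have := msum_lits_le C
  omega

/-! ### One step of the simulation, per rule -/

section Steps

variable {Φ : PropForm ℕ} {W LF B K STEP ℓ : ℕ} {S : List (PropForm ℕ)}

/-- **Initial clause.** [folklore] -/
theorem step_initial {T : CNF ℕ} (hΦ : Φ = PropForm.ofCNF T) {c : Clause ℕ} (hc : c ∈ T)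
    {C : Finset (Literal ℕ)} (hcl : c.toFinset = C) (hCW : C.card ≤ W)
    (hLF : Φ.size + 3 * W + 3 ≤ LF) (hB : 16 * LF + 60 ≤ B) (hcK : c.length + 2 ≤ K)
    (hTK : T.length + W + 4 ≤ K) (hSTEP : 300 * K ^ 2 ≤ STEP)
    (h : ∃ Pd : List (PropForm ℕ), textbookFrege.IsDerivation ∅ Pd ∧
      (∀ ψ ∈ S, ψ ∈ Pd) ∧ Pd.length ≤ ℓ ∧ ∀ ψ ∈ Pd, LineOK 10 B ψ) :
    ∃ Pd : List (PropForm ℕ), textbookFrege.IsDerivation ∅ Pd ∧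
      (∀ ψ ∈ disjList (neg Φ :: C.toList.map litOf) :: S, ψ ∈ Pd) ∧ Pd.length ≤ ℓ + STEP ∧
      ∀ ψ ∈ Pd, LineOK 10 B ψ := by
  subst hΦ
  have t := initialTaut (D := 10) (B := B) hc (LC := C.toList.map litOf) (LF := LF)
    le_rfl (fun A hA => dd_of_mem_lits hA) (fun l' hl' => mem_lits_iff.2
      ⟨l', by rw [← hcl]; exact List.mem_toFinset.2 hl', rfl⟩) (by omega)
    ((size_lineF_le hCW).trans hLF) hB
  have a := cont_absorb h t
  refine ⟨_, a.choose_spec.1, a.choose_spec.2.1, le_trans a.choose_spec.2.2.1 ?_,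
    a.choose_spec.2.2.2⟩
  have hLC : (C.toList.map litOf).length ≤ W := by
    rw [List.length_map, Finset.length_toList]; exact hCW
  have : 34 + 126 * T.length + (c.length + 2) * (35 + 6 * ((C.toList.map litOf).length + 2)) ≤ STEP := by
    calc _ ≤ 34 + 126 * K + K * (35 + 6 * K) := by
          have := Nat.mul_le_mul hcK (show 35 + 6 * ((C.toList.map litOf).length + 2) ≤ 35 + 6 * K by
            omega)
          omega
      _ ≤ 300 * K ^ 2 := by nlinarith
      _ ≤ STEP := hSTEP
  omega

/-- **Resolution step.** [folklore] -/
theorem step_resolve (hdΦn : (neg Φ).dd ≤ 4) {Ci Cj C : Finset (Literal ℕ)} {v : ℕ}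
    (hE : C = Ci.erase (v, true) ∪ Cj.erase (v, false))
    (hFi : disjList (neg Φ :: Ci.toList.map litOf) ∈ S) (hFj : disjList (neg Φ :: Cj.toList.map litOf) ∈ S)
    (hCiW : Ci.card ≤ W) (hCjW : Cj.card ≤ W) (hCW : C.card ≤ W)
    (hLF : Φ.size + 3 * W + 3 ≤ LF) (hB : 16 * LF + 60 ≤ B) (hWK : W + 4 ≤ K)
    (hSTEP : 300 * K ^ 2 ≤ STEP)
    (h : ∃ Pd : List (PropForm ℕ), textbookFrege.IsDerivation ∅ Pd ∧
      (∀ ψ ∈ S, ψ ∈ Pd) ∧ Pd.length ≤ ℓ ∧ ∀ ψ ∈ Pd, LineOK 10 B ψ) :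
    ∃ Pd : List (PropForm ℕ), textbookFrege.IsDerivation ∅ Pd ∧
      (∀ ψ ∈ disjList (neg Φ :: C.toList.map litOf) :: S, ψ ∈ Pd) ∧ Pd.length ≤ ℓ + STEP ∧
      ∀ ψ ∈ Pd, LineOK 10 B ψ := by
  have hsz : ∀ C' : Finset (Literal ℕ), C'.card ≤ W →
      (disjList (neg Φ :: C'.toList.map litOf)).size ≤ LF := fun C' hC' => (size_lineF_le hC').trans hLF
  have hddF : ∀ C' : Finset (Literal ℕ), (disjList (neg Φ :: C'.toList.map litOf)).dd ≤ 4 :=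
    fun C' => dd_cons_le hdΦn fun A hA => (dd_of_mem_lits hA).trans (by omega)
  -- the tautology
  have t := resolveTaut (D := 10) (B := B) (Li := Ci.toList.map litOf) (Lj := Cj.toList.map litOf)
    (LE := C.toList.map litOf) (Φn := neg Φ) (x := var v) (LF := LF) le_rfl hdΦn
    (fun A hA => dd_of_mem_lits hA) (fun A hA => dd_of_mem_lits hA)
    (fun A hA => dd_of_mem_lits hA) (by simp) (by simp) (by simp [size])
    (fun A hA => by
      obtain ⟨l', hl', rfl⟩ := mem_lits_iff.1 hA
      by_cases h' : l' = (v, true)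
      · left; subst h'; simp [litOf]
      · right
        have hmem : l' ∈ C := by
          rw [hE]; exact Finset.mem_union_left _ (Finset.mem_erase.2 ⟨h', hl'⟩)
        exact mem_lits_iff.2 ⟨l', hmem, rfl⟩)
    (fun A hA => by
      obtain ⟨l', hl', rfl⟩ := mem_lits_iff.1 hA
      by_cases h' : l' = (v, false)
      · left; subst h'; simp [litOf]
      · right
        have hmem : l' ∈ C := by
          rw [hE]; exact Finset.mem_union_right _ (Finset.mem_erase.2 ⟨h', hl'⟩)
        exact mem_lits_iff.2 ⟨l', hmem, rfl⟩)
    (hsz _ hCiW) (hsz _ hCjW) (hsz _ hCW) hB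
  have a := cont_absorb h t
  -- two modus ponens steps
  set Fi := disjList (neg Φ :: Ci.toList.map litOf) with hFidef
  set Fj := disjList (neg Φ :: Cj.toList.map litOf) with hFjdef
  set FE := disjList (neg Φ :: C.toList.map litOf) with hFEdef
  have hsFi : Fi.size ≤ LF := hsz _ hCiW
  have hsFj : Fj.size ≤ LF := hsz _ hCjW
  have hsFE : FE.size ≤ LF := hsz _ hCW
  have hdFi : Fi.dd ≤ 4 := hddF Ci
  have hdFj : Fj.dd ≤ 4 := hddF Cj
  have hdFE : FE.dd ≤ 4 := hddF C
  have hdnFj : (neg Fj).dd ≤ 6 := (dd_neg_le_dd_add_two Fj).trans (by omega)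
  have hdG : (disj (neg Fj) FE).dd ≤ 6 := by rw [dd_disj]; omega
  have hdnG : (neg (disj (neg Fj) FE)).dd ≤ 8 := (dd_neg_le_dd_add_two _).trans (by omega)
  have hdnFE : (neg FE).dd ≤ 6 := (dd_neg_le_dd_add_two FE).trans (by omega)
  have m1 := mp_in (A := Fi) (F := disj (neg Fj) FE) (by simp [hFi]) (List.mem_cons_self)
    ⟨_, a.choose_spec.1, a.choose_spec.2.1, a.choose_spec.2.2.1, a.choose_spec.2.2.2⟩
    (hdFi.trans (by omega)) (hdG.trans (by omega)) (hdnG.trans (by omega))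
    (by simp only [size]; omega)
  have m2 := mp_in (A := Fj) (F := FE) (by simp [hFj]) (List.mem_cons_self)
    ⟨_, m1.choose_spec.1, m1.choose_spec.2.1, m1.choose_spec.2.2.1, m1.choose_spec.2.2.2.1⟩
    (hdFj.trans (by omega)) (hdFE.trans (by omega)) (hdnFE.trans (by omega)) (by omega)
  obtain ⟨Pd', hPd', hS', hlen', hok', -⟩ := m2
  refine ⟨Pd', hPd', fun ψ hψ => hS' ψ ?_, le_trans hlen' ?_, hok'⟩
  · rcases List.mem_cons.1 hψ with rfl | hψ
    · exact List.mem_cons_self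
    · simp [hψ]
  · have hLi : (Ci.toList.map litOf).length ≤ W := by
      rw [List.length_map, Finset.length_toList]; exact hCiW
    have hLj : (Cj.toList.map litOf).length ≤ W := by
      rw [List.length_map, Finset.length_toList]; exact hCjW
    have hLE : (C.toList.map litOf).length ≤ W := by
      rw [List.length_map, Finset.length_toList]; exact hCW
    have : 30 + 2 * ((Ci.toList.map litOf).length + (Cj.toList.map litOf).length + 2) *
        (35 + 6 * ((C.toList.map litOf).length + 4)) + 5 + 5 ≤ STEP := by
      calc _ ≤ 40 + 2 * (2 * K) * (35 + 6 * K) := by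
            have := Nat.mul_le_mul
              (show 2 * ((Ci.toList.map litOf).length + (Cj.toList.map litOf).length + 2) ≤
                2 * (2 * K) by omega)
              (show 35 + 6 * ((C.toList.map litOf).length + 4) ≤ 35 + 6 * K by omega)
            omega
        _ ≤ 300 * K ^ 2 := by nlinarith
        _ ≤ STEP := hSTEP
    omega

/-- **Weakening step.** [folklore] -/
theorem step_weaken (hdΦn : (neg Φ).dd ≤ 4) {Ci C : Finset (Literal ℕ)} (hsub : Ci ⊆ C)
    (hFi : disjList (neg Φ :: Ci.toList.map litOf) ∈ S) (hCiW : Ci.card ≤ W) (hCW : C.card ≤ W)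
    (hLF : Φ.size + 3 * W + 3 ≤ LF) (hB : 16 * LF + 60 ≤ B) (hWK : W + 4 ≤ K)
    (hSTEP : 300 * K ^ 2 ≤ STEP)
    (h : ∃ Pd : List (PropForm ℕ), textbookFrege.IsDerivation ∅ Pd ∧
      (∀ ψ ∈ S, ψ ∈ Pd) ∧ Pd.length ≤ ℓ ∧ ∀ ψ ∈ Pd, LineOK 10 B ψ) :
    ∃ Pd : List (PropForm ℕ), textbookFrege.IsDerivation ∅ Pd ∧
      (∀ ψ ∈ disjList (neg Φ :: C.toList.map litOf) :: S, ψ ∈ Pd) ∧ Pd.length ≤ ℓ + STEP ∧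
      ∀ ψ ∈ Pd, LineOK 10 B ψ := by
  have hsz : ∀ C' : Finset (Literal ℕ), C'.card ≤ W →
      (disjList (neg Φ :: C'.toList.map litOf)).size ≤ LF := fun C' hC' => (size_lineF_le hC').trans hLF
  have hddF : ∀ C' : Finset (Literal ℕ), (disjList (neg Φ :: C'.toList.map litOf)).dd ≤ 4 :=
    fun C' => dd_cons_le hdΦn fun A hA => (dd_of_mem_lits hA).trans (by omega)
  have t := weakenTaut (D := 10) (B := B) (Li := Ci.toList.map litOf)
    (LE := C.toList.map litOf) (Φn := neg Φ) (LF := LF) le_rfl hdΦn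
    (fun A hA => dd_of_mem_lits hA) (fun A hA => dd_of_mem_lits hA)
    (fun A hA => by
      obtain ⟨l', hl', rfl⟩ := mem_lits_iff.1 hA
      exact mem_lits_iff.2 ⟨l', hsub hl', rfl⟩)
    (hsz _ hCiW) (hsz _ hCW) hB
  have a := cont_absorb h t
  set Fi := disjList (neg Φ :: Ci.toList.map litOf) with hFidef
  set FE := disjList (neg Φ :: C.toList.map litOf) with hFEdef
  have hsFi : Fi.size ≤ LF := hsz _ hCiW
  have hsFE : FE.size ≤ LF := hsz _ hCW
  have hdFi : Fi.dd ≤ 4 := hddF Ci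
  have hdFE : FE.dd ≤ 4 := hddF C
  have hdnFE : (neg FE).dd ≤ 6 := (dd_neg_le_dd_add_two FE).trans (by omega)
  have m1 := mp_in (A := Fi) (F := FE) (by simp [hFi]) (List.mem_cons_self)
    ⟨_, a.choose_spec.1, a.choose_spec.2.1, a.choose_spec.2.2.1, a.choose_spec.2.2.2⟩
    (hdFi.trans (by omega)) (hdFE.trans (by omega)) (hdnFE.trans (by omega)) (by omega)
  obtain ⟨Pd', hPd', hS', hlen', hok', -⟩ := m1
  refine ⟨Pd', hPd', fun ψ hψ => hS' ψ ?_, le_trans hlen' ?_, hok'⟩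
  · rcases List.mem_cons.1 hψ with rfl | hψ
    · exact List.mem_cons_self
    · simp [hψ]
  · have hLi : (Ci.toList.map litOf).length ≤ W := by
      rw [List.length_map, Finset.length_toList]; exact hCiW
    have hLE : (C.toList.map litOf).length ≤ W := by
      rw [List.length_map, Finset.length_toList]; exact hCW
    have : 14 + ((Ci.toList.map litOf).length + 2) * (35 + 6 * ((C.toList.map litOf).length + 2))
        + 5 ≤ STEP := by
      calc _ ≤ 19 + K * (35 + 6 * K) := by
            have := Nat.mul_le_mul (show (Ci.toList.map litOf).length + 2 ≤ K by omega)
              (show 35 + 6 * ((C.toList.map litOf).length + 2) ≤ 35 + 6 * K by omega)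
            omega
        _ ≤ 300 * K ^ 2 := by nlinarith
        _ ≤ STEP := hSTEP
    omega

end Steps

/-! ### The simulation -/

/-- **Bounded-depth `textbookFrege` p-simulates resolution.** A resolution refutation `ρ` of a CNF
`T` (the tree's dag-like calculus `IsResRefutation`, with weakening) all of whose clauses have at
most `W` literals yields a depth-`11` `textbookFrege` proof of `¬ ofCNF T` of size at most
`(|ρ| + 1) · 300 K² · (16 (|ofCNF T| + 3W + 3) + 60)` with `K = |ofCNF T| + 2W + |T| + 4`.
[Cook–Reckhow 1979, §2 (folklore p-simulation); Shoenfield 1967, §2.6, §3.1] -/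
theorem exists_proof_of_isResRefutation (T : CNF ℕ) (ρ : List (ResLine ℕ)) (W : ℕ)
    (hW : ∀ l ∈ ρ, l.clause.card ≤ W) (hρ : IsResRefutation T ρ) :
    ∃ π, textbookFrege.IsDepthProofOf 11 π (neg (PropForm.ofCNF T)) ∧
      proofSize π ≤ (ρ.length + 1) * (300 * ((PropForm.ofCNF T).size + 2 * W + T.length + 4) ^ 2) *
        (16 * ((PropForm.ofCNF T).size + 3 * W + 3) + 60) := by
  classical
  set Φ := PropForm.ofCNF T with hΦ
  set LF : ℕ := Φ.size + 3 * W + 3 with hLF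
  set B : ℕ := 16 * LF + 60 with hB
  set K : ℕ := Φ.size + 2 * W + T.length + 4 with hK
  set STEP : ℕ := 300 * K ^ 2 with hSTEP
  -- depth of `¬Φ`
  have hdΦn : (neg Φ).dd ≤ 4 := by
    rw [hΦ, KrajicekRamsey.ofCNF_eq_conjList]
    exact (dd_neg_conjList_le (p := 1) fun X hX => by
      obtain ⟨c', -, rfl⟩ := List.mem_map.1 hX
      exact dd_clauseOf_le c').trans (by omega)
  have hρd := hρ.1
  -- the invariant after `k` lines
  have main : ∀ k, k ≤ ρ.length → ∃ Pd : List (PropForm ℕ), textbookFrege.IsDerivation ∅ Pd ∧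
      (∀ ψ ∈ (ρ.take k).map (fun l => disjList (neg Φ :: l.clause.toList.map litOf)), ψ ∈ Pd) ∧
      Pd.length ≤ k * STEP ∧ ∀ ψ ∈ Pd, LineOK 10 B ψ := by
    intro k
    induction k with
    | zero =>
      intro _
      exact ⟨[], FregeSystem.isDerivation_nil _ _, by simp, by simp, by simp⟩
    | succ k ih =>
      intro hk
      have hk' : k < ρ.length := hk
      have hcont := ih hk'.le
      set S := (ρ.take k).map (fun l => disjList (neg Φ :: l.clause.toList.map litOf)) with hSdef
      set l := ρ[k] with hl
      have hlW : l.clause.card ≤ W := hW l (List.getElem_mem hk')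
      have htake : ρ.take (k + 1) = ρ.take k ++ [l] := by
        rw [hl, List.take_succ_eq_append_getElem hk']
      have hmemS : ∀ i (hi : i < (ρ.take k).length),
          disjList (neg Φ :: ((ρ.take k)[i]).clause.toList.map litOf) ∈ S := fun i hi =>
        List.mem_map.2 ⟨(ρ.take k)[i], List.getElem_mem hi, rfl⟩
      have hWtake : ∀ i (hi : i < (ρ.take k).length), ((ρ.take k)[i]).clause.card ≤ W :=
        fun i hi => hW _ (List.mem_of_mem_take (List.getElem_mem hi))
      -- it suffices to reach the new sequent within `STEP` more lines
      suffices hnew : ∃ Pd : List (PropForm ℕ), textbookFrege.IsDerivation ∅ Pd ∧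
          (∀ ψ ∈ disjList (neg Φ :: l.clause.toList.map litOf) :: S, ψ ∈ Pd) ∧
          Pd.length ≤ k * STEP + STEP ∧ ∀ ψ ∈ Pd, LineOK 10 B ψ by
        obtain ⟨Pd', hPd', hS', hlen', hok'⟩ := hnew
        refine ⟨Pd', hPd', fun ψ hψ => hS' ψ ?_, by rw [Nat.succ_mul]; exact hlen', hok'⟩
        rw [htake, List.map_append, List.mem_append] at hψ
        rcases hψ with hψ | hψ
        · exact List.mem_cons_of_mem _ hψ
        · simp only [List.map_cons, List.map_nil, List.mem_singleton] at hψ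
          exact hψ ▸ List.mem_cons_self
      have hvalid := hρd k hk'
      rw [← hl] at hvalid
      unfold IsValidResLine at hvalid
      split at hvalid
      next =>
        obtain ⟨c, hc, hcl⟩ := List.mem_map.1 hvalid
        have hlenc : c.length + 2 ≤ K := by
          have h1 : (clauseOf c).size ≤ Φ.size := by
            rw [hΦ, KrajicekRamsey.ofCNF_eq_conjList, size_conjList_eq_msum]
            have hm : clauseOf c ∈ T.map clauseOf := List.mem_map.2 ⟨c, hc, rfl⟩
            have := msum_le_of_sublist (List.singleton_sublist.2 hm)
            simp only [msum_cons, msum_nil] at this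
            omega
          have h2 : c.length ≤ (clauseOf c).size := by
            unfold clauseOf
            rw [size_disjList_eq_msum]
            have := length_le_msum (c.map litOf)
            rw [List.length_map] at this
            omega
          omega
        exact step_initial hΦ hc hcl hlW (by omega) le_rfl hlenc (by omega) le_rfl hcont
      next i j v _ =>
        obtain ⟨hi, hj, -, -, hE⟩ := hvalid
        exact step_resolve hdΦn hE (hmemS i hi) (hmemS j hj) (hWtake i hi) (hWtake j hj) hlW
          (by omega) le_rfl (by omega) le_rfl hcont
      next i _ =>
        obtain ⟨hi, hsub⟩ := hvalid
        exact step_weaken hdΦn hsub (hmemS i hi) (hWtake i hi) hlW (by omega) le_rfl (by omega)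
          le_rfl hcont
  -- the empty clause, and the final modus ponens
  obtain ⟨Pd, hPd, hS, hlen, hok⟩ := main ρ.length le_rfl
  rw [List.take_length] at hS
  obtain ⟨l₀, hl₀, hempty⟩ := hρ.2
  have t := finalTaut (D := 10) (B := B) (Φn := neg Φ) le_rfl hdΦn (by simp only [size]; omega)
  have a := cont_absorb ⟨Pd, hPd, hS, hlen, hok⟩ t
  have hF0' : disjList [neg Φ] ∈ disj (neg (disjList [neg Φ])) (neg Φ) ::
      (ρ.map fun l => disjList (neg Φ :: l.clause.toList.map litOf)) :=
    List.mem_cons_of_mem _ (List.mem_map.2 ⟨l₀, hl₀, by rw [hempty]; simp⟩)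
  have m := mp_in (A := disjList [neg Φ]) (F := neg Φ) hF0' List.mem_cons_self
    ⟨_, a.choose_spec.1, a.choose_spec.2.1, a.choose_spec.2.2.1, a.choose_spec.2.2.2⟩
    (dd_cons_le (p := 10) (hdΦn.trans (by omega)) (by simp)) (hdΦn.trans (by omega))
    ((dd_neg_le_dd_add_two (neg Φ)).trans (by omega))
    (by simp only [size_disjList_cons, size_disjList_nil, size]; omega)
  obtain ⟨Pf, hPf, -, hlenf, hokf, hlastf⟩ := m
  refine ⟨Pf, ⟨⟨hPf, hlastf⟩, fun ψ hψ => (altDepth_le_dd_succ ψ).trans (by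
    have := (hokf ψ hψ).1; omega)⟩, ?_⟩
  -- size
  have hlines : Pf.length ≤ (ρ.length + 1) * STEP := by
    have : 10 + 5 ≤ STEP := by
      have : 1 ≤ K := by omega
      nlinarith
    rw [Nat.succ_mul]; omega
  unfold proofSize
  calc (Pf.map PropForm.size).sum ≤ (Pf.map fun _ => B).sum :=
        List.sum_le_sum fun ψ hψ => (hokf ψ hψ).2
    _ = Pf.length * B := by simp [List.sum_replicate]
    _ ≤ (ρ.length + 1) * STEP * B := Nat.mul_le_mul_right _ hlines

end Summit.PneNP.PneNP.Theorems.ResSim
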